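import Mathlib

/-!
# An archimedean box principle and integer polynomials with small Hasse derivatives (soloist)

Soloist file (`solo-Schanuel-informed`, session s148, 2026-08-29).  This is the Dirichlet
(box-principle) side of D. Roy's *small value estimates for the additive group*
[Roy2010 = D. Roy, Small value estimates for the additive group, Int. J. Number Theory **6**
(2010), arXiv:0708.2307, §12, Prop. 12.1 with `m = 1`], typed at FINITE LEVEL with explicit
numerical hypotheses; the asymptotic form (Roy's exponents `β, σ, τ, ν`) is derived from it in
`SoloInformedRoyAdditiveDirichlet`.  Nothing here is deep: the point is that the archimedean
Thue–Siegel–Dirichlet box principle for finitely many real or complex linear forms, which the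
tree lacked (it has the ultrametric one, `Literature.NumberTheory.Transcendental.PadicBox.
exists_small_int_combination`, and Mathlib's Siegel lemma for exact solutions,
`Int.Matrix.exists_ne_zero_int_vec_norm_le`), is now a
kernel-checked tool, and that the "trivial direction" of the additive small value estimates of
the soloist's statement (atlas §2 E5, §5 W1 of `paper/SHARPEST.md`) is a theorem and no longer a
citation.

## Statements

* §1 `exists_int_small_linearForms` — given real linear forms `L j = ∑ₖ L j k · Xₖ`
  (`j ∈ ι`, `k ∈ κ`, both finite) with `|L j k| ≤ A`, a height `H : ℕ`, a box radius `R : ℕ`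
  with `card κ · A · H ≤ R · δ` and the counting hypothesis `(2R+1)^{card ι} < (H+1)^{card κ}`,
  there is `z ∈ ℤ^κ ∖ {0}` with `|z k| ≤ H` and `|L j (z)| < δ` for every `j`.
  Proof: pigeonhole (`Finset.exists_ne_map_eq_of_card_lt_of_maps_to`) on the map
  `x ↦ (⌊L j (x)/δ⌋)ⱼ` from `{0,…,H}^κ` to `{-R,…,R}^ι`, then `z = x − y`.
* `exists_int_small_linearForms_complex` — the same for complex forms, with `2 · card ι` in the
  exponent and `‖L j (z)‖ < 2δ` (split into real and imaginary parts).
* §2 `aeval_hasseDeriv_ofFn` — for `P = ofFn (n+1) z = ∑ₖ z k X^k ∈ ℤ[X]`, the value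
  `P^{[j]}(x) = ∑ₖ C(k,j) x^{k-j} z k` of the `j`-th Hasse (divided) derivative is a linear form
  in the coefficient vector; `norm_choose_mul_pow_le` bounds its coefficients at `x = iξ`,
  `i ≤ I`, by `2^n (1 + I‖ξ‖)^n`.
* `exists_int_poly_small_hasseDeriv` — for `ξ ∈ ℂ` and naturals `n, I, J, H, R` with
  `(n+1) · 2^n (1 + I‖ξ‖)^n · H ≤ R · δ` and `(2R+1)^{2(I+1)(J+1)} < (H+1)^{n+1}` there is
  `P ∈ ℤ[X] ∖ {0}` with `deg P ≤ n`, all `|coeff| ≤ H`, and `‖P^{[j]}(iξ)‖ < 2δ` for all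
  `0 ≤ i ≤ I`, `0 ≤ j ≤ J`.

## Reading

This is the generic construction of [Roy2010, proof of Prop. 12.1] ("a result of
Thue–Siegel–Dirichlet, [Wa2, Lemma 4.12]"), specialised to one point `ξ` (`m = 1`).  It is used
only through the last theorem; the box principle itself is stated in the generality that the
ultrametric file uses, so that other small-value / auxiliary-polynomial constructions on this
summit can cite it instead of re-proving it.
-/

namespace Summit.Schanuel.Schanuel.Theorems

open Finset Polynomial

/-! ## §1 The box principle (Thue–Siegel–Dirichlet) for real and complex linear forms -/

section BoxPrinciple

variable {ι κ : Type*} [Fintype ι] [Fintype κ]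

/-- **Archimedean box principle for real linear forms.**  Let `L j k ∈ ℝ` (`j ∈ ι`, `k ∈ κ`)
with `|L j k| ≤ A`, let `0 < δ`, and let `H R : ℕ` satisfy `card κ · A · H ≤ R · δ` and
`(2R+1)^{card ι} < (H+1)^{card κ}`.  Then some non-zero `z ∈ ℤ^κ` with `|z k| ≤ H` has
`|∑ₖ L j k · z k| < δ` for every `j`.  (Pigeonhole on `x ↦ (⌊∑ₖ L j k x k / δ⌋)ⱼ`,
`x ∈ {0,…,H}^κ`.) -/
theorem exists_int_small_linearForms (L : ι → κ → ℝ) {A δ : ℝ} (hδ : 0 < δ)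
    (hA : ∀ j k, |L j k| ≤ A) (H R : ℕ)
    (hR : (Fintype.card κ : ℝ) * A * H ≤ R * δ)
    (hcard : (2 * R + 1) ^ Fintype.card ι < (H + 1) ^ Fintype.card κ) :
    ∃ z : κ → ℤ, z ≠ 0 ∧ (∀ k, |z k| ≤ H) ∧ ∀ j, |∑ k, L j k * z k| < δ := by
  classical
  -- the two boxes
  let S : Finset (κ → ℕ) := Fintype.piFinset fun _ => Finset.range (H + 1)
  let T : Finset (ι → ℤ) := Fintype.piFinset fun _ => Finset.Icc (-(R : ℤ)) R
  -- the linear forms on natural vectors and the pigeonhole map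
  let V : (κ → ℕ) → ι → ℝ := fun x j => ∑ k, L j k * (x k : ℝ)
  let f : (κ → ℕ) → ι → ℤ := fun x j => ⌊V x j / δ⌋
  have hS : S.card = (H + 1) ^ Fintype.card κ := by
    simp only [S, Fintype.card_piFinset, Finset.card_range, Finset.prod_const, Finset.card_univ]
  have hT : T.card = (2 * R + 1) ^ Fintype.card ι := by
    simp only [T, Fintype.card_piFinset, Int.card_Icc, Finset.prod_const, Finset.card_univ]
    have : (R : ℤ) + 1 - -(R : ℤ) = ((2 * R + 1 : ℕ) : ℤ) := by push_cast; ring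
    rw [this, Int.toNat_natCast]
  have hTS : T.card < S.card := by rw [hS, hT]; exact hcard
  -- bound on the forms over the box `S`
  have hV : ∀ x ∈ S, ∀ j, |V x j| ≤ R * δ := by
    intro x hx j
    have hxk : ∀ k, (x k : ℝ) ≤ H := by
      intro k
      have := Fintype.mem_piFinset.mp hx k
      rw [Finset.mem_range] at this
      exact_mod_cast Nat.lt_succ_iff.mp this
    calc |V x j| ≤ ∑ k, |L j k * (x k : ℝ)| := Finset.abs_sum_le_sum_abs _ _
      _ ≤ ∑ _k : κ, A * H := by
          refine Finset.sum_le_sum fun k _ => ?_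
          rw [abs_mul, Nat.abs_cast]
          have hA0 : 0 ≤ A := (abs_nonneg _).trans (hA j k)
          exact mul_le_mul (hA j k) (hxk k) (Nat.cast_nonneg _) hA0
      _ = Fintype.card κ * A * H := by
          rw [Finset.sum_const, Finset.card_univ, nsmul_eq_mul]; ring
      _ ≤ R * δ := hR
  have hf : Set.MapsTo f S T := by
    intro x hx
    rw [Finset.mem_coe] at hx ⊢
    refine Fintype.mem_piFinset.mpr fun j => Finset.mem_Icc.mpr ⟨?_, ?_⟩
    · have h1 : -(R * δ) ≤ V x j := (abs_le.mp (hV x hx j)).1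
      have h2 : (((-(R : ℤ)) : ℤ) : ℝ) ≤ V x j / δ := by
        rw [le_div_iff₀ hδ]; push_cast; linarith
      exact Int.le_floor.mpr h2
    · have h1 : V x j ≤ R * δ := (abs_le.mp (hV x hx j)).2
      have h2 : V x j / δ ≤ R := by rw [div_le_iff₀ hδ]; exact h1
      have h3 : ((⌊V x j / δ⌋ : ℤ) : ℝ) ≤ (R : ℤ) := by
        push_cast; exact (Int.floor_le _).trans h2
      exact_mod_cast h3
  -- two pigeons in one hole
  obtain ⟨x, hx, y, hy, hxy, hfxy⟩ := Finset.exists_ne_map_eq_of_card_lt_of_maps_to hTS hf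
  refine ⟨fun k => (x k : ℤ) - (y k : ℤ), ?_, ?_, ?_⟩
  · -- non-zero
    intro hz
    apply hxy
    funext k
    have := congr_fun hz k
    simp only [Pi.zero_apply, sub_eq_zero] at this
    exact_mod_cast this
  · -- height
    intro k
    have hxk := Fintype.mem_piFinset.mp hx k
    have hyk := Fintype.mem_piFinset.mp hy k
    rw [Finset.mem_range] at hxk hyk
    dsimp only
    rw [abs_le]
    constructor <;> omega
  · -- smallness
    intro j
    have h1 : |V x j / δ - V y j / δ| < 1 :=
      Int.abs_sub_lt_one_of_floor_eq_floor (congr_fun hfxy j)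
    rw [← sub_div, abs_div, abs_of_pos hδ, div_lt_one hδ] at h1
    have h2 : ∑ k, L j k * (((x k : ℤ) - (y k : ℤ) : ℤ) : ℝ) = V x j - V y j := by
      simp only [V, ← Finset.sum_sub_distrib, ← mul_sub]
      refine Finset.sum_congr rfl fun k _ => ?_
      push_cast; ring
    rw [h2]
    exact h1

/-- **Archimedean box principle for complex linear forms.**  As `exists_int_small_linearForms`
with `‖L j k‖ ≤ A`, the exponent `2 · card ι` (real and imaginary parts) and the conclusion
`‖∑ₖ L j k · z k‖ < 2δ`. -/
theorem exists_int_small_linearForms_complex (L : ι → κ → ℂ) {A δ : ℝ} (hδ : 0 < δ)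
    (hA : ∀ j k, ‖L j k‖ ≤ A) (H R : ℕ)
    (hR : (Fintype.card κ : ℝ) * A * H ≤ R * δ)
    (hcard : (2 * R + 1) ^ (2 * Fintype.card ι) < (H + 1) ^ Fintype.card κ) :
    ∃ z : κ → ℤ, z ≠ 0 ∧ (∀ k, |z k| ≤ H) ∧ ∀ j, ‖∑ k, L j k * z k‖ < 2 * δ := by
  classical
  let L' : ι ⊕ ι → κ → ℝ := fun s k => Sum.elim (fun j => (L j k).re) (fun j => (L j k).im) s
  have hA' : ∀ s k, |L' s k| ≤ A := by
    rintro (j | j) k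
    · exact (Complex.abs_re_le_norm _).trans (hA j k)
    · exact (Complex.abs_im_le_norm _).trans (hA j k)
  have hcard' : (2 * R + 1) ^ Fintype.card (ι ⊕ ι) < (H + 1) ^ Fintype.card κ := by
    rwa [Fintype.card_sum, ← two_mul]
  obtain ⟨z, hz0, hzH, hz⟩ := exists_int_small_linearForms L' hδ hA' H R hR hcard'
  refine ⟨z, hz0, hzH, fun j => ?_⟩
  have hre : (∑ k, L j k * (z k : ℂ)).re = ∑ k, L' (Sum.inl j) k * z k := by
    rw [Complex.re_sum]
    refine Finset.sum_congr rfl fun k _ => ?_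
    simp [L', Complex.mul_re]
  have him : (∑ k, L j k * (z k : ℂ)).im = ∑ k, L' (Sum.inr j) k * z k := by
    rw [Complex.im_sum]
    refine Finset.sum_congr rfl fun k _ => ?_
    simp [L', Complex.mul_im]
  calc ‖∑ k, L j k * (z k : ℂ)‖
      ≤ |(∑ k, L j k * (z k : ℂ)).re| + |(∑ k, L j k * (z k : ℂ)).im| :=
        Complex.norm_le_abs_re_add_abs_im _
    _ < δ + δ := add_lt_add (by rw [hre]; exact hz _) (by rw [him]; exact hz _)
    _ = 2 * δ := by ring

end BoxPrinciple

/-! ## §2 Integer polynomials with small Hasse derivatives at the points `iξ` -/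

/-- The `j`-th Hasse derivative of `P = ∑_{k ≤ n} z_k X^k` evaluated at `x` is the linear form
`∑ₖ C(k,j) x^{k-j} z_k` in the coefficient vector `z`.  (Terms with `k < j` vanish because
`C(k,j) = 0`.) -/
theorem aeval_hasseDeriv_ofFn (n j : ℕ) (z : Fin (n + 1) → ℤ) (x : ℂ) :
    aeval x (hasseDeriv j (ofFn (n + 1) z)) =
      ∑ k : Fin (n + 1), (((k : ℕ).choose j : ℕ) : ℂ) * x ^ ((k : ℕ) - j) * (z k : ℂ) := by
  rw [ofFn_eq_sum_monomial, map_sum, map_sum]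
  refine Finset.sum_congr rfl fun k _ => ?_
  rw [hasseDeriv_monomial, aeval_monomial, algebraMap_int_eq, eq_intCast]
  push_cast
  ring

/-- Coefficient bound for the forms of `aeval_hasseDeriv_ofFn` at `x = iξ`, `i ≤ I`, `k ≤ n`:
`‖C(k,j) (iξ)^{k-j}‖ ≤ 2^n (1 + I‖ξ‖)^n`. -/
theorem norm_choose_mul_pow_le {n : ℕ} (k : Fin (n + 1)) (j : ℕ) {i I : ℕ} (hi : i ≤ I)
    (ξ : ℂ) :
    ‖((((k : ℕ).choose j : ℕ) : ℂ)) * (((i : ℕ) : ℂ) * ξ) ^ ((k : ℕ) - j)‖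
      ≤ 2 ^ n * (1 + I * ‖ξ‖) ^ n := by
  have hk : (k : ℕ) ≤ n := Nat.lt_succ_iff.mp k.isLt
  rw [norm_mul, norm_pow, norm_mul, Complex.norm_natCast, Complex.norm_natCast]
  have h0 : 0 ≤ (i : ℝ) * ‖ξ‖ := by positivity
  have h1 : (((k : ℕ).choose j : ℕ) : ℝ) ≤ 2 ^ n :=
    calc (((k : ℕ).choose j : ℕ) : ℝ) ≤ 2 ^ (k : ℕ) := by
          exact_mod_cast Nat.choose_le_two_pow _ _
      _ ≤ 2 ^ n := pow_le_pow_right₀ (by norm_num) hk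
  have hI0 : (0 : ℝ) ≤ I * ‖ξ‖ := by positivity
  have hiI : (i : ℝ) * ‖ξ‖ ≤ 1 + I * ‖ξ‖ := by
    have hi' : (i : ℝ) ≤ I := by exact_mod_cast hi
    have : (i : ℝ) * ‖ξ‖ ≤ I * ‖ξ‖ := mul_le_mul_of_nonneg_right hi' (norm_nonneg _)
    linarith
  have h2 : ((i : ℝ) * ‖ξ‖) ^ ((k : ℕ) - j) ≤ (1 + I * ‖ξ‖) ^ n :=
    calc ((i : ℝ) * ‖ξ‖) ^ ((k : ℕ) - j) ≤ (1 + I * ‖ξ‖) ^ ((k : ℕ) - j) :=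
          pow_le_pow_left₀ h0 hiI _
      _ ≤ (1 + I * ‖ξ‖) ^ n := pow_le_pow_right₀ (by linarith) (by omega)
  exact mul_le_mul h1 h2 (by positivity) (by positivity)

/-- **Finite-level Dirichlet side of the additive small value estimate** [Roy2010, proof of
Prop. 12.1, `m = 1`].  For `ξ ∈ ℂ`, `0 < δ` and naturals `n, I, J, H, R` with
`(n+1) · 2^n (1 + I‖ξ‖)^n · H ≤ R · δ` and `(2R+1)^{2(I+1)(J+1)} < (H+1)^{n+1}`, there is a
non-zero `P ∈ ℤ[X]` of degree `≤ n` with all coefficients of absolute value `≤ H` such that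
`‖P^{[j]}(iξ)‖ < 2δ` for all naturals `i ≤ I`, `j ≤ J` (`P^{[j]}` the Hasse derivative). -/
theorem exists_int_poly_small_hasseDeriv (ξ : ℂ) (n I J H R : ℕ) {δ : ℝ} (hδ : 0 < δ)
    (hR : ((n + 1 : ℕ) : ℝ) * (2 ^ n * (1 + I * ‖ξ‖) ^ n) * H ≤ R * δ)
    (hcard : (2 * R + 1) ^ (2 * ((I + 1) * (J + 1))) < (H + 1) ^ (n + 1)) :
    ∃ P : ℤ[X], P ≠ 0 ∧ P.natDegree ≤ n ∧ (∀ m, |P.coeff m| ≤ H) ∧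
      ∀ i j : ℕ, i ≤ I → j ≤ J → ‖aeval (((i : ℕ) : ℂ) * ξ) (hasseDeriv j P)‖ < 2 * δ := by
  classical
  -- the linear forms: index `(i, j) ∈ Fin (I+1) × Fin (J+1)`, unknowns `k ∈ Fin (n+1)`
  let L : Fin (I + 1) × Fin (J + 1) → Fin (n + 1) → ℂ := fun p k =>
    ((((k : ℕ).choose (p.2 : ℕ) : ℕ) : ℂ)) * ((((p.1 : ℕ) : ℕ) : ℂ) * ξ) ^ ((k : ℕ) - (p.2 : ℕ))
  have hA : ∀ p k, ‖L p k‖ ≤ 2 ^ n * (1 + I * ‖ξ‖) ^ n := fun p k =>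
    norm_choose_mul_pow_le k _ (Nat.lt_succ_iff.mp p.1.isLt) ξ
  have hR' : (Fintype.card (Fin (n + 1)) : ℝ) * (2 ^ n * (1 + I * ‖ξ‖) ^ n) * H ≤ R * δ := by
    rw [Fintype.card_fin]; exact hR
  have hcard' : (2 * R + 1) ^ (2 * Fintype.card (Fin (I + 1) × Fin (J + 1)))
      < (H + 1) ^ Fintype.card (Fin (n + 1)) := by
    simp only [Fintype.card_prod, Fintype.card_fin]; exact hcard
  obtain ⟨z, hz0, hzH, hz⟩ := exists_int_small_linearForms_complex L hδ hA H R hR' hcard'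
  refine ⟨ofFn (n + 1) z, ?_, ?_, ?_, ?_⟩
  · exact fun h => hz0 (injective_ofFn (n + 1) (h.trans (map_zero _).symm))
  · exact Nat.lt_succ_iff.mp (ofFn_natDegree_lt (Nat.succ_pos n) z)
  · intro m
    by_cases hm : m < n + 1
    · rw [ofFn_coeff_eq_val_of_lt z hm]; exact hzH _
    · rw [ofFn_coeff_eq_zero_of_ge z (not_lt.mp hm)]; simp
  · intro i j hi hj
    have key := hz (⟨i, Nat.lt_succ_of_le hi⟩, ⟨j, Nat.lt_succ_of_le hj⟩)
    rw [aeval_hasseDeriv_ofFn]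
    exact key

end Summit.Schanuel.Schanuel.Theorems
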